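import Summits.AtomisticToContinuum.FouriersLaw.Theorems.EmbeddedDrudeMourreAbelThermodynamicLimitAnchoredCorrelationTails
import Mathlib.Analysis.SpecificLimits.Normed

/-!
# Leaf (B₀) `stub_fixedTimeOffsetMatching` of S4, dynamic half, part 4: the current error and the radius threshold
(crux `EmbeddedDrudeMourre.AbelThermodynamicLimit`, item stmt-AtomisticToContinuum-12596, line
`loomis-compact-horizon-witness`; `--supports` file proving the registered sub-goal `stub_dynamicalMatchingRadius`;
closes nothing)

* §1 the bond current `j_x = -½(p_x + p_{x+1}) V'(q_{x+1} - q_x)` of the pinned chain is locally Lipschitz in the four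
  coordinates it reads: with positions in `[-ρ, ρ]`, momenta of the comparison configuration `≤ Pm`, position gaps
  `≤ eq` and momentum gaps `≤ ep`, `|Δj_x| ≤ ep(2ρ + 8βρ³) + Pm(1 + 12βρ²)(2eq)` (`V'(r) = r + βr³`);
* §2 THE RADIUS THRESHOLD `stub_dynamicalMatchingRadius`: with `ρ = (2+2t)√R`, `Θ = ω₂ + 3 lam ρ² + 4(1+12βρ²)` and
  depth `R - |x|`, beyond some `R₀` the regime `2e√Θ t ≤ 2(R - |x|) - 1` of the pathwise core (part 1) holds, the
  resulting current error `O(R⁴ 4^{-R})` on the good event is `≤ ε`, and the bad-event probability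
  `(2R+3)C/(lam R²/4) + (2R+3)K/R⁸ = O(1/R)` (part 3) is `≤ ε` (elementary real estimates; `n⁴ rⁿ → 0`, `C/n → 0`).

All statements proved; `[folklore]`. No definitions.
-/

noncomputable section

namespace Summit.AtomisticToContinuum.FouriersLaw.Theorems.AbelThermodynamicLimit.LoomisCompactHorizonWitness

open MeasureTheory ProbabilityTheory Set Filter Topology Function
open scoped NNReal ENNReal
open Literature.MathematicalPhysics.KineticTheory Literature.MathematicalPhysics.KineticTheory.HeatConduction
open Literature.Probability.Process OscillatorChain
open Summit.AtomisticToContinuum.FouriersLaw.Theorems.NonBallistic.LightConePropagation (abs_cubic_sub_cubic_le)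
variable {ω₂ lam β γ : ℝ}

/-! ### §1 The bond current is locally Lipschitz in the four coordinates it reads -/

/-- **Local Lipschitz bound for the bond current of the pinned chain.** If at the sites `x, x+1` the positions of
`σ₁` and `σ₂` lie in `[-ρ, ρ]`, the momenta of `σ₂` are bounded by `Pm`, the positions differ by at most `eq` and
the momenta by at most `ep`, then
`|j_x(σ₁) − j_x(σ₂)| ≤ ep (2ρ + 8βρ³) + Pm (1 + 12βρ²) (2 eq)` (`V'(r) = r + βr³`, elongations `≤ 2ρ`). [folklore] -/
theorem abs_bondCurrentZ_sub_le (ω₂ lam : ℝ) (hβ : 0 ≤ β) (γ : ℝ) {σ₁ σ₂ : ChainConfig} {x : ℤ}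
    {ρ ep eq Pm : ℝ} (hq1 : |(σ₁ x).1| ≤ ρ) (hq1' : |(σ₁ (x + 1)).1| ≤ ρ) (hq2 : |(σ₂ x).1| ≤ ρ)
    (hq2' : |(σ₂ (x + 1)).1| ≤ ρ) (hp2 : |(σ₂ x).2| ≤ Pm) (hp2' : |(σ₂ (x + 1)).2| ≤ Pm)
    (hdp : |(σ₁ x).2 - (σ₂ x).2| ≤ ep) (hdp' : |(σ₁ (x + 1)).2 - (σ₂ (x + 1)).2| ≤ ep)
    (hdq : |(σ₁ x).1 - (σ₂ x).1| ≤ eq) (hdq' : |(σ₁ (x + 1)).1 - (σ₂ (x + 1)).1| ≤ eq) :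
    |(pinnedChain ω₂ lam β γ).bondCurrentZ σ₁ x - (pinnedChain ω₂ lam β γ).bondCurrentZ σ₂ x| ≤
      ep * (2 * ρ + 8 * β * ρ ^ 3) + Pm * ((1 + 12 * β * ρ ^ 2) * (2 * eq)) := by
  have hρ : 0 ≤ ρ := (abs_nonneg _).trans hq1
  have hep : 0 ≤ ep := (abs_nonneg _).trans hdp
  have heq : 0 ≤ eq := (abs_nonneg _).trans hdq
  have hPm : 0 ≤ Pm := (abs_nonneg _).trans hp2
  set r₁ : ℝ := (σ₁ (x + 1)).1 - (σ₁ x).1 with hr₁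
  set r₂ : ℝ := (σ₂ (x + 1)).1 - (σ₂ x).1 with hr₂
  set A₁ : ℝ := ((σ₁ x).2 + (σ₁ (x + 1)).2) / 2 with hA₁
  set A₂ : ℝ := ((σ₂ x).2 + (σ₂ (x + 1)).2) / 2 with hA₂
  have hr₁b : |r₁| ≤ 2 * ρ := by
    rw [hr₁]; exact (abs_sub _ _).trans (by linarith)
  have hr₂b : |r₂| ≤ 2 * ρ := by
    rw [hr₂]; exact (abs_sub _ _).trans (by linarith)
  have hdr : |r₁ - r₂| ≤ 2 * eq := by
    have e : r₁ - r₂ = ((σ₁ (x + 1)).1 - (σ₂ (x + 1)).1) - ((σ₁ x).1 - (σ₂ x).1) := by rw [hr₁, hr₂]; ring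
    rw [e]; exact (abs_sub _ _).trans (by linarith)
  have hdA : |A₁ - A₂| ≤ ep := by
    have e : A₁ - A₂ = (((σ₁ x).2 - (σ₂ x).2) + ((σ₁ (x + 1)).2 - (σ₂ (x + 1)).2)) / 2 := by rw [hA₁, hA₂]; ring
    rw [e, abs_div, abs_two]
    have := abs_add_le ((σ₁ x).2 - (σ₂ x).2) ((σ₁ (x + 1)).2 - (σ₂ (x + 1)).2)
    linarith
  have hA₂b : |A₂| ≤ Pm := by
    rw [hA₂, abs_div, abs_two]
    have := abs_add_le (σ₂ x).2 (σ₂ (x + 1)).2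
    linarith
  -- `V'(r) = r + β r³`
  have hV1 : |r₁ + β * r₁ ^ 3| ≤ 2 * ρ + 8 * β * ρ ^ 3 := by
    have h3 : |r₁| ^ 3 ≤ (2 * ρ) ^ 3 := pow_le_pow_left₀ (abs_nonneg _) hr₁b 3
    calc |r₁ + β * r₁ ^ 3| ≤ |r₁| + |β * r₁ ^ 3| := abs_add_le _ _
      _ = |r₁| + β * |r₁| ^ 3 := by rw [abs_mul, abs_of_nonneg hβ, abs_pow]
      _ ≤ 2 * ρ + β * (2 * ρ) ^ 3 := add_le_add hr₁b (mul_le_mul_of_nonneg_left h3 hβ)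
      _ = 2 * ρ + 8 * β * ρ ^ 3 := by ring
  have hdV : |(r₁ + β * r₁ ^ 3) - (r₂ + β * r₂ ^ 3)| ≤ (1 + 12 * β * ρ ^ 2) * (2 * eq) := by
    have h := abs_cubic_sub_cubic_le (c₁ := 1) (c₃ := β) zero_le_one hβ hr₁b hr₂b
    rw [one_mul, one_mul] at h
    calc |(r₁ + β * r₁ ^ 3) - (r₂ + β * r₂ ^ 3)| ≤ (1 + 3 * β * (2 * ρ) ^ 2) * |r₁ - r₂| := h
      _ = (1 + 12 * β * ρ ^ 2) * |r₁ - r₂| := by ring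
      _ ≤ (1 + 12 * β * ρ ^ 2) * (2 * eq) := mul_le_mul_of_nonneg_left hdr (by positivity)
  -- the current `j = -(A · V'(r))`
  have hj : ∀ σ : ChainConfig, (pinnedChain ω₂ lam β γ).bondCurrentZ σ x =
      -(((σ x).2 + (σ (x + 1)).2) / 2 * (((σ (x + 1)).1 - (σ x).1) + β * ((σ (x + 1)).1 - (σ x).1) ^ 3)) := by
    intro σ
    rw [OscillatorChain.bondCurrentZ, pinnedChain_deriv_V]
  rw [hj, hj]
  change |-(A₁ * (r₁ + β * r₁ ^ 3)) - -(A₂ * (r₂ + β * r₂ ^ 3))| ≤ _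
  have e : -(A₁ * (r₁ + β * r₁ ^ 3)) - -(A₂ * (r₂ + β * r₂ ^ 3)) =
      -((A₁ - A₂) * (r₁ + β * r₁ ^ 3) + A₂ * ((r₁ + β * r₁ ^ 3) - (r₂ + β * r₂ ^ 3))) := by ring
  rw [e, abs_neg]
  calc |(A₁ - A₂) * (r₁ + β * r₁ ^ 3) + A₂ * ((r₁ + β * r₁ ^ 3) - (r₂ + β * r₂ ^ 3))|
      ≤ |(A₁ - A₂) * (r₁ + β * r₁ ^ 3)| + |A₂ * ((r₁ + β * r₁ ^ 3) - (r₂ + β * r₂ ^ 3))| := abs_add_le _ _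
    _ = |A₁ - A₂| * |r₁ + β * r₁ ^ 3| + |A₂| * |(r₁ + β * r₁ ^ 3) - (r₂ + β * r₂ ^ 3)| := by rw [abs_mul, abs_mul]
    _ ≤ ep * (2 * ρ + 8 * β * ρ ^ 3) + Pm * ((1 + 12 * β * ρ ^ 2) * (2 * eq)) :=
        add_le_add (mul_le_mul hdA hV1 (abs_nonneg _) hep) (mul_le_mul hA₂b hdV (abs_nonneg _) hPm)

/-! ### §2 The radius threshold -/

/-- `(1/2)^{2(R-k)} = 4^k (1/4)^R` and `(1/2)^{2(R-k)-1} = 2 · 4^k (1/4)^R` for `k + 1 ≤ R`. [folklore] -/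
theorem half_pow_depth_eq (k R : ℕ) (hk : k + 1 ≤ R) :
    ((1 : ℝ) / 2) ^ (2 * (R - k)) = 4 ^ k * (1 / 4) ^ R ∧
      ((1 : ℝ) / 2) ^ (2 * (R - k) - 1) = 2 * 4 ^ k * (1 / 4) ^ R := by
  obtain ⟨m, rfl⟩ : ∃ m, R = k + (m + 1) := ⟨R - k - 1, by omega⟩
  have e1 : k + (m + 1) - k = m + 1 := by omega
  rw [e1]
  have h4 : (4 : ℝ) ^ k * (1 / 4) ^ k = 1 := by rw [← mul_pow]; norm_num
  have hq : ((1 : ℝ) / 2) ^ (2 * (m + 1)) = (1 / 4) ^ (m + 1) := by rw [pow_mul]; norm_num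
  have hq' : ((1 : ℝ) / 2) ^ (2 * (m + 1) - 1) = (1 / 4) ^ m * (1 / 2) := by
    rw [show 2 * (m + 1) - 1 = 2 * m + 1 by omega, pow_succ, pow_mul]; norm_num
  refine ⟨?_, ?_⟩
  · rw [hq, pow_add (1 / 4 : ℝ) k (m + 1), ← mul_assoc, h4, one_mul]
  · rw [hq', pow_add (1 / 4 : ℝ) k (m + 1), pow_succ]
    calc ((1 : ℝ) / 4) ^ m * (1 / 2) = 1 * ((1 / 4) ^ m * (1 / 2)) := by ring
      _ = (4 : ℝ) ^ k * (1 / 4) ^ k * ((1 / 4) ^ m * (1 / 2)) := by rw [h4]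
      _ = 2 * 4 ^ k * ((1 / 4) ^ k * ((1 / 4) ^ m * (1 / 4))) := by ring


/-- The current error of the dynamic half as a real inequality: with `0 ≤ s ≤ r`, `s² = r ≥ 1`, `√θ ≤ K₁ r`,
`(2 a s √θ · 2·4ᵏq)(2as + 8β(as)³) + (√(lam/2) r)((1 + 12β(as)²)(2·(2as·4ᵏq))) ≤ Kbig · r⁴ q`. [folklore] -/
theorem errJ_le_aux {a s r θ q β lam K₁ : ℝ} (k : ℕ) (ha : 0 ≤ a) (hβ : 0 ≤ β) (hK₁ : 0 ≤ K₁) (hs0 : 0 ≤ s)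
    (hsr : s ≤ r) (hs2 : s ^ 2 = r) (hr1 : 1 ≤ r) (hθ : Real.sqrt θ ≤ K₁ * r) (hq0 : 0 ≤ q) :
    (2 * (a * s) * Real.sqrt θ * (2 * 4 ^ k * q)) * (2 * (a * s) + 8 * β * (a * s) ^ 3) +
        (Real.sqrt (lam / 2) * r) * ((1 + 12 * β * (a * s) ^ 2) * (2 * (2 * (a * s) * (4 ^ k * q)))) ≤
      (4 * a * K₁ * 4 ^ k * (2 * a + 8 * β * a ^ 3) + 4 * a * Real.sqrt (lam / 2) * (1 + 12 * β * a ^ 2) * 4 ^ k) *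
        (r ^ 4 * q) := by
  have hr0 : 0 ≤ r := zero_le_one.trans hr1
  have h1 : 2 * (a * s) * Real.sqrt θ * (2 * 4 ^ k * q) ≤ 4 * a * K₁ * 4 ^ k * (r ^ 2 * q) := by
    have : (a * s) * Real.sqrt θ ≤ (a * r) * (K₁ * r) :=
      mul_le_mul (mul_le_mul_of_nonneg_left hsr ha) hθ (Real.sqrt_nonneg _) (by positivity)
    calc 2 * (a * s) * Real.sqrt θ * (2 * 4 ^ k * q) = 4 * 4 ^ k * q * ((a * s) * Real.sqrt θ) := by ring
      _ ≤ 4 * 4 ^ k * q * ((a * r) * (K₁ * r)) := mul_le_mul_of_nonneg_left this (by positivity)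
      _ = 4 * a * K₁ * 4 ^ k * (r ^ 2 * q) := by ring
  have h2 : 2 * (a * s) + 8 * β * (a * s) ^ 3 ≤ (2 * a + 8 * β * a ^ 3) * r ^ 2 := by
    have hs3 : s ^ 3 ≤ r ^ 2 := by
      calc s ^ 3 = s ^ 2 * s := by ring
        _ ≤ r * r := mul_le_mul (le_of_eq hs2) hsr hs0 hr0
        _ = r ^ 2 := by ring
    have hsR2 : s ≤ r ^ 2 := hsr.trans (le_self_pow₀ hr1 (by norm_num))
    calc 2 * (a * s) + 8 * β * (a * s) ^ 3 = 2 * a * s + 8 * β * a ^ 3 * s ^ 3 := by ring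
      _ ≤ 2 * a * r ^ 2 + 8 * β * a ^ 3 * r ^ 2 :=
          add_le_add (mul_le_mul_of_nonneg_left hsR2 (by positivity)) (mul_le_mul_of_nonneg_left hs3 (by positivity))
      _ = (2 * a + 8 * β * a ^ 3) * r ^ 2 := by ring
  have h3 : (1 + 12 * β * (a * s) ^ 2) ≤ (1 + 12 * β * a ^ 2) * r := by
    calc (1 + 12 * β * (a * s) ^ 2) = 1 + 12 * β * a ^ 2 * r := by rw [mul_pow, hs2]; ring
      _ ≤ r + 12 * β * a ^ 2 * r := add_le_add hr1 le_rfl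
      _ = (1 + 12 * β * a ^ 2) * r := by ring
  have h4 : 2 * (2 * (a * s) * (4 ^ k * q)) ≤ 4 * a * 4 ^ k * (r * q) := by
    calc 2 * (2 * (a * s) * (4 ^ k * q)) = 4 * a * 4 ^ k * (s * q) := by ring
      _ ≤ 4 * a * 4 ^ k * (r * q) := by gcongr
  have hT1 : 2 * (a * s) * Real.sqrt θ * (2 * 4 ^ k * q) * (2 * (a * s) + 8 * β * (a * s) ^ 3) ≤
      (4 * a * K₁ * 4 ^ k * (2 * a + 8 * β * a ^ 3)) * (r ^ 4 * q) := by
    calc _ ≤ (4 * a * K₁ * 4 ^ k * (r ^ 2 * q)) * ((2 * a + 8 * β * a ^ 3) * r ^ 2) :=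
          mul_le_mul h1 h2 (by positivity) (by positivity)
      _ = _ := by ring
  have hT2 : Real.sqrt (lam / 2) * r * ((1 + 12 * β * (a * s) ^ 2) * (2 * (2 * (a * s) * (4 ^ k * q)))) ≤
      (4 * a * Real.sqrt (lam / 2) * (1 + 12 * β * a ^ 2) * 4 ^ k) * (r ^ 4 * q) := by
    have hin : (1 + 12 * β * (a * s) ^ 2) * (2 * (2 * (a * s) * (4 ^ k * q))) ≤
        ((1 + 12 * β * a ^ 2) * r) * (4 * a * 4 ^ k * (r * q)) := mul_le_mul h3 h4 (by positivity) (by positivity)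
    have hr34 : r ^ 3 ≤ r ^ 4 := pow_le_pow_right₀ hr1 (by norm_num)
    calc _ ≤ Real.sqrt (lam / 2) * r * (((1 + 12 * β * a ^ 2) * r) * (4 * a * 4 ^ k * (r * q))) :=
          mul_le_mul_of_nonneg_left hin (by positivity)
      _ = (4 * a * Real.sqrt (lam / 2) * (1 + 12 * β * a ^ 2) * 4 ^ k) * (r ^ 3 * q) := by ring
      _ ≤ (4 * a * Real.sqrt (lam / 2) * (1 + 12 * β * a ^ 2) * 4 ^ k) * (r ^ 4 * q) :=
          mul_le_mul_of_nonneg_left (mul_le_mul_of_nonneg_right hr34 hq0) (by positivity)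
  calc _ ≤ (4 * a * K₁ * 4 ^ k * (2 * a + 8 * β * a ^ 3)) * (r ^ 4 * q) +
        (4 * a * Real.sqrt (lam / 2) * (1 + 12 * β * a ^ 2) * 4 ^ k) * (r ^ 4 * q) := add_le_add hT1 hT2
    _ = _ := by ring

/-- The regime of the dynamic half as a real inequality: with `M ≤ s`, `s² = r`, `1 ≤ s`, `√θ ≤ √K₁ s`,
`M = 2 e t √K₁ + 2k + 1`, one has `2e √θ t ≤ 2(r - k) - 1`. [folklore] -/
theorem regime_aux {s r θ K₁ t : ℝ} {k : ℕ} (ht : 0 ≤ t) (hs1 : 1 ≤ s) (hs2 : s ^ 2 = r)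
    (hM : 2 * Real.exp 1 * t * Real.sqrt K₁ + 2 * k + 1 ≤ s) (hθ : Real.sqrt θ ≤ Real.sqrt K₁ * s) :
    2 * Real.exp 1 * (Real.sqrt θ * t) ≤ 2 * (r - k) - 1 := by
  have hs0 : 0 ≤ s := zero_le_one.trans hs1
  have hr : r = s * s := by rw [← hs2, sq]
  have h2 : (2 * Real.exp 1 * t * Real.sqrt K₁ + 2 * k + 1) * s ≤ r := by
    rw [hr]; exact mul_le_mul_of_nonneg_right hM hs0
  have h3 : (2 * (k : ℝ) + 1) * 1 ≤ (2 * (k : ℝ) + 1) * s := mul_le_mul_of_nonneg_left hs1 (by positivity)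
  have hr0 : 0 ≤ r := by rw [hr]; positivity
  calc 2 * Real.exp 1 * (Real.sqrt θ * t) ≤ 2 * Real.exp 1 * (Real.sqrt K₁ * s * t) := by gcongr
    _ = (2 * Real.exp 1 * t * Real.sqrt K₁ + 2 * k + 1) * s - (2 * k + 1) * s := by ring
    _ ≤ r - (2 * k + 1) * 1 := by linarith
    _ ≤ 2 * (r - k) - 1 := by linarith

/-- The bad-event probability as a real inequality: for `r ≥ 1`,
`(2r+3)C/(lam r²/4) + (2r+3)(K/r⁸) ≤ (20C/lam + 5K)/r`. [folklore] -/
theorem prob_le_aux {r lam Cr Kt : ℝ} (hr1 : 1 ≤ r) (hl : 0 < lam) (hCr : 0 ≤ Cr) (hKt : 0 ≤ Kt) :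
    (2 * r + 3) * Cr / (lam * r ^ 2 / 4) + (2 * r + 3) * (Kt / r ^ 8) ≤ (20 * Cr / lam + 5 * Kt) / r := by
  have hr0 : 0 < r := by linarith
  have h5 : 2 * r + 3 ≤ 5 * r := by linarith
  have hA : (2 * r + 3) * Cr / (lam * r ^ 2 / 4) ≤ 20 * Cr / lam / r := by
    rw [div_le_div_iff₀ (by positivity) hr0]
    calc (2 * r + 3) * Cr * r ≤ 5 * r * Cr * r := by gcongr
      _ = 20 * Cr / lam * (lam * r ^ 2 / 4) := by field_simp; ring
  have hB : (2 * r + 3) * (Kt / r ^ 8) ≤ 5 * Kt / r := by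
    rw [mul_div_assoc', div_le_div_iff₀ (by positivity) hr0]
    have hR8 : r * r ≤ r ^ 8 := by
      calc r * r = r ^ 2 := by ring
        _ ≤ r ^ 8 := pow_le_pow_right₀ hr1 (by norm_num)
    calc (2 * r + 3) * Kt * r ≤ 5 * r * Kt * r := by gcongr
      _ = 5 * Kt * (r * r) := by ring
      _ ≤ 5 * Kt * r ^ 8 := mul_le_mul_of_nonneg_left hR8 (by positivity)
  calc _ ≤ 20 * Cr / lam / r + 5 * Kt / r := add_le_add hA hB
    _ = (20 * Cr / lam + 5 * Kt) / r := by ring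

/-- **The radius threshold.** For the explicit error terms of the dynamic half — regime of the iteration, the
pathwise current error on the good event (`ρ = (2+2t)√R`, `Θ = ω₂ + 3 lam ρ² + 4(1+12βρ²)`, depth `R - |x|`), and the
bad-event probability `(2R+3)C/(lam R²/4) + (2R+3)K/R⁸` — there is `R₀` beyond which the regime holds, the current
error is `≤ ε` and the probability is `≤ ε` (current error `O(R⁴ 4^{-R})`, probability `O(1/R)`). [folklore] -/
theorem exists_radius_threshold (hω : 0 ≤ ω₂) (hl : 0 < lam) (hβ : 0 ≤ β) {t : ℝ} (ht : 0 ≤ t) (x : ℤ)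
    {ε : ℝ} (hε : 0 < ε) {Cr Kt : ℝ} (hCr : 0 ≤ Cr) (hKt : 0 ≤ Kt) :
    ∃ R₀ : ℕ, ∀ R : ℕ, R₀ ≤ R →
      x.natAbs + 1 ≤ R ∧ 1 ≤ R ∧
      2 * Real.exp 1 * (Real.sqrt (ω₂ + 3 * lam * ((2 + 2 * t) * Real.sqrt R) ^ 2 +
          4 * (1 + 12 * β * ((2 + 2 * t) * Real.sqrt R) ^ 2)) * t) ≤ 2 * ((R : ℝ) - x.natAbs) - 1 ∧
      (2 * ((2 + 2 * t) * Real.sqrt R) * Real.sqrt (ω₂ + 3 * lam * ((2 + 2 * t) * Real.sqrt R) ^ 2 +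
            4 * (1 + 12 * β * ((2 + 2 * t) * Real.sqrt R) ^ 2)) * (1 / 2) ^ (2 * (R - x.natAbs) - 1)) *
          (2 * ((2 + 2 * t) * Real.sqrt R) + 8 * β * ((2 + 2 * t) * Real.sqrt R) ^ 3) +
        (Real.sqrt (lam / 2) * R) * ((1 + 12 * β * ((2 + 2 * t) * Real.sqrt R) ^ 2) *
          (2 * (2 * ((2 + 2 * t) * Real.sqrt R) * (1 / 2) ^ (2 * (R - x.natAbs))))) ≤ ε ∧
      (2 * (R : ℝ) + 3) * Cr / (lam * (R : ℝ) ^ 2 / 4) + (2 * (R : ℝ) + 3) * (Kt / (R : ℝ) ^ 8) ≤ ε := by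
  have ha0 : 0 ≤ 2 + 2 * t := by positivity
  have hK₁0 : 0 ≤ ω₂ + 4 + (3 * lam + 48 * β) * (2 + 2 * t) ^ 2 := by positivity
  -- facts valid for every `R ≥ 1`
  have hfacts : ∀ R : ℕ, 1 ≤ R →
      (1 : ℝ) ≤ R ∧ Real.sqrt R ≤ R ∧ 1 ≤ Real.sqrt (R : ℝ) ∧ Real.sqrt (R : ℝ) ^ 2 = R ∧
      (ω₂ + 3 * lam * ((2 + 2 * t) * Real.sqrt R) ^ 2 + 4 * (1 + 12 * β * ((2 + 2 * t) * Real.sqrt R) ^ 2)) ≤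
          (ω₂ + 4 + (3 * lam + 48 * β) * (2 + 2 * t) ^ 2) * R ∧
      1 ≤ (ω₂ + 3 * lam * ((2 + 2 * t) * Real.sqrt R) ^ 2 + 4 * (1 + 12 * β * ((2 + 2 * t) * Real.sqrt R) ^ 2)) := by
    intro R hR
    have hr1 : (1 : ℝ) ≤ R := by exact_mod_cast hR
    have hs2 : Real.sqrt (R : ℝ) ^ 2 = R := Real.sq_sqrt (by positivity)
    have hs1 : 1 ≤ Real.sqrt (R : ℝ) := by rw [← Real.sqrt_one]; exact Real.sqrt_le_sqrt hr1
    have hsR : Real.sqrt (R : ℝ) ≤ R := by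
      calc Real.sqrt (R : ℝ) = Real.sqrt R * 1 := (mul_one _).symm
        _ ≤ Real.sqrt R * Real.sqrt R := mul_le_mul_of_nonneg_left hs1 (Real.sqrt_nonneg _)
        _ = R := by rw [← sq, hs2]
    refine ⟨hr1, hsR, hs1, hs2, ?_, ?_⟩
    · have h1 : ω₂ + 4 ≤ (ω₂ + 4) * R := le_mul_of_one_le_right (by positivity) hr1
      calc ω₂ + 3 * lam * ((2 + 2 * t) * Real.sqrt R) ^ 2 + 4 * (1 + 12 * β * ((2 + 2 * t) * Real.sqrt R) ^ 2)
          = (ω₂ + 4) + (3 * lam + 48 * β) * (2 + 2 * t) ^ 2 * R := by rw [mul_pow, hs2]; ring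
        _ ≤ (ω₂ + 4) * R + (3 * lam + 48 * β) * (2 + 2 * t) ^ 2 * R := add_le_add h1 le_rfl
        _ = (ω₂ + 4 + (3 * lam + 48 * β) * (2 + 2 * t) ^ 2) * R := by ring
    · have : 0 ≤ 3 * lam * ((2 + 2 * t) * Real.sqrt R) ^ 2 := by positivity
      have : 0 ≤ 12 * β * ((2 + 2 * t) * Real.sqrt R) ^ 2 := by positivity
      linarith
  -- (i) the regime beyond `⌈M²⌉ + 1`
  obtain ⟨M, hMdef⟩ : ∃ M : ℝ, M = 2 * Real.exp 1 * t * Real.sqrt (ω₂ + 4 + (3 * lam + 48 * β) * (2 + 2 * t) ^ 2) +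
      2 * x.natAbs + 1 := ⟨_, rfl⟩
  have hM0 : 0 ≤ M := by rw [hMdef]; positivity
  have hreg : ∀ R : ℕ, ⌈M ^ 2⌉₊ + 1 ≤ R → 1 ≤ R →
      2 * Real.exp 1 * (Real.sqrt (ω₂ + 3 * lam * ((2 + 2 * t) * Real.sqrt R) ^ 2 +
        4 * (1 + 12 * β * ((2 + 2 * t) * Real.sqrt R) ^ 2)) * t) ≤ 2 * ((R : ℝ) - x.natAbs) - 1 := by
    intro R hR hR1
    obtain ⟨hr1, -, hs1, hs2, hΘ, -⟩ := hfacts R hR1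
    have hRM : M ≤ Real.sqrt R := by
      have h1 : M ^ 2 ≤ (R : ℝ) := by
        have : (⌈M ^ 2⌉₊ : ℝ) + 1 ≤ R := by exact_mod_cast hR
        linarith [Nat.le_ceil (M ^ 2)]
      calc M = Real.sqrt (M ^ 2) := (Real.sqrt_sq hM0).symm
        _ ≤ Real.sqrt R := Real.sqrt_le_sqrt h1
    rw [hMdef] at hRM
    refine regime_aux ht hs1 hs2 hRM ?_
    rw [← Real.sqrt_mul hK₁0]
    exact Real.sqrt_le_sqrt (by rw [← hs2] at hΘ; rw [sq] at hΘ; nlinarith [hΘ, hs2])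
  -- (ii) the current error is eventually `≤ ε`
  obtain ⟨Kbig, hKbig⟩ : ∃ Kbig : ℝ, Kbig = 4 * (2 + 2 * t) * (ω₂ + 4 + (3 * lam + 48 * β) * (2 + 2 * t) ^ 2) *
      4 ^ x.natAbs * (2 * (2 + 2 * t) + 8 * β * (2 + 2 * t) ^ 3) +
      4 * (2 + 2 * t) * Real.sqrt (lam / 2) * (1 + 12 * β * (2 + 2 * t) ^ 2) * 4 ^ x.natAbs := ⟨_, rfl⟩
  have herr : ∀ R : ℕ, x.natAbs + 1 ≤ R → 1 ≤ R →
      (2 * ((2 + 2 * t) * Real.sqrt R) * Real.sqrt (ω₂ + 3 * lam * ((2 + 2 * t) * Real.sqrt R) ^ 2 +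
            4 * (1 + 12 * β * ((2 + 2 * t) * Real.sqrt R) ^ 2)) * (1 / 2) ^ (2 * (R - x.natAbs) - 1)) *
          (2 * ((2 + 2 * t) * Real.sqrt R) + 8 * β * ((2 + 2 * t) * Real.sqrt R) ^ 3) +
        (Real.sqrt (lam / 2) * R) * ((1 + 12 * β * ((2 + 2 * t) * Real.sqrt R) ^ 2) *
          (2 * (2 * ((2 + 2 * t) * Real.sqrt R) * (1 / 2) ^ (2 * (R - x.natAbs))))) ≤
        Kbig * ((R : ℝ) ^ 4 * (1 / 4) ^ R) := by
    intro R hRk hR1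
    obtain ⟨hr1, hsR, -, hs2, hΘ, hΘ1⟩ := hfacts R hR1
    obtain ⟨e0, e1⟩ := half_pow_depth_eq x.natAbs R hRk
    rw [e0, e1, hKbig]
    refine errJ_le_aux x.natAbs ha0 hβ hK₁0 (Real.sqrt_nonneg _) hsR hs2 hr1 ?_ (by positivity)
    calc Real.sqrt _ ≤ Real.sqrt ((ω₂ + 3 * lam * ((2 + 2 * t) * Real.sqrt R) ^ 2 +
          4 * (1 + 12 * β * ((2 + 2 * t) * Real.sqrt R) ^ 2)) ^ 2) := Real.sqrt_le_sqrt (by nlinarith)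
      _ = _ := Real.sqrt_sq (by linarith)
      _ ≤ _ := hΘ
  have hev2 : ∀ᶠ R : ℕ in atTop, Kbig * ((R : ℝ) ^ 4 * (1 / 4) ^ R) ≤ ε := by
    have h := (tendsto_pow_const_mul_const_pow_of_lt_one 4 (by norm_num : (0:ℝ) ≤ 1 / 4)
      (by norm_num : (1:ℝ) / 4 < 1)).const_mul Kbig
    rw [mul_zero] at h
    exact (h.eventually (ge_mem_nhds hε)).mono fun R hR => hR
  -- (iii) the probability is eventually `≤ ε`
  have hev3 : ∀ᶠ R : ℕ in atTop, (20 * Cr / lam + 5 * Kt) / (R : ℝ) ≤ ε :=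
    ((tendsto_const_div_atTop_nhds_zero_nat (20 * Cr / lam + 5 * Kt)).eventually (ge_mem_nhds hε)).mono
      fun R hR => hR
  -- combine
  obtain ⟨R₂, hR₂⟩ := Filter.eventually_atTop.1 (hev2.and hev3)
  refine ⟨max (max (x.natAbs + 1) (⌈M ^ 2⌉₊ + 1)) R₂, fun R hR => ?_⟩
  have hRk : x.natAbs + 1 ≤ R := le_trans (le_trans (le_max_left _ _) (le_max_left _ _)) hR
  have hR1' : ⌈M ^ 2⌉₊ + 1 ≤ R := le_trans (le_trans (le_max_right _ _) (le_max_left _ _)) hR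
  have hR₂' : R₂ ≤ R := le_trans (le_max_right _ _) hR
  have hR1 : 1 ≤ R := by omega
  have hr1 : (1 : ℝ) ≤ R := by exact_mod_cast hR1
  obtain ⟨h2, h3⟩ := hR₂ R hR₂'
  exact ⟨hRk, hR1, hreg R hR1' hR1, (herr R hRk hR1).trans h2, (prob_le_aux hr1 hl hCr hKt).trans h3⟩



/-- **Registered sub-goal `stub_dynamicalMatchingRadius`** (dynamic half of leaf (B₀), line `loomis-compact-horizon-witness`):
the radius threshold of the dynamic half (`exists_radius_threshold`, closed form). [folklore] -/
theorem stub_dynamicalMatchingRadius :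
    ∀ ω₂ lam β : ℝ, 0 ≤ ω₂ → 0 < lam → 0 ≤ β → ∀ (t : ℝ), 0 ≤ t → ∀ (x : ℤ) (ε : ℝ), 0 < ε →
      ∀ (Cr Kt : ℝ), 0 ≤ Cr → 0 ≤ Kt →
      ∃ R₀ : ℕ, ∀ R : ℕ, R₀ ≤ R →
        x.natAbs + 1 ≤ R ∧ 1 ≤ R ∧
        2 * Real.exp 1 * (Real.sqrt (ω₂ + 3 * lam * ((2 + 2 * t) * Real.sqrt R) ^ 2 +
            4 * (1 + 12 * β * ((2 + 2 * t) * Real.sqrt R) ^ 2)) * t) ≤ 2 * ((R : ℝ) - x.natAbs) - 1 ∧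
        (2 * ((2 + 2 * t) * Real.sqrt R) * Real.sqrt (ω₂ + 3 * lam * ((2 + 2 * t) * Real.sqrt R) ^ 2 +
              4 * (1 + 12 * β * ((2 + 2 * t) * Real.sqrt R) ^ 2)) * (1 / 2) ^ (2 * (R - x.natAbs) - 1)) *
            (2 * ((2 + 2 * t) * Real.sqrt R) + 8 * β * ((2 + 2 * t) * Real.sqrt R) ^ 3) +
          (Real.sqrt (lam / 2) * R) * ((1 + 12 * β * ((2 + 2 * t) * Real.sqrt R) ^ 2) *
            (2 * (2 * ((2 + 2 * t) * Real.sqrt R) * (1 / 2) ^ (2 * (R - x.natAbs))))) ≤ ε ∧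
        (2 * (R : ℝ) + 3) * Cr / (lam * (R : ℝ) ^ 2 / 4) + (2 * (R : ℝ) + 3) * (Kt / (R : ℝ) ^ 8) ≤ ε :=
  fun _ _ _ hω hl hβ _ ht x _ hε _ _ hCr hKt => exists_radius_threshold hω hl hβ ht x hε hCr hKt

end Summit.AtomisticToContinuum.FouriersLaw.Theorems.AbelThermodynamicLimit.LoomisCompactHorizonWitness

end
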